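import Summits.BirchSwinnertonDyer.BirchSwinnertonDyer.Theorems.SchneiderFreeAdditiveX3KYLambdaAlgCharRelaxationOfPrintFiveLe
import Summits.BirchSwinnertonDyer.BirchSwinnertonDyer.Theorems.EisensteinPrimesXAcImprimitiveNoPTorsionOfPoitouTateAt
import Summits.BirchSwinnertonDyer.BirchSwinnertonDyer.Theorems.SignedBaseChangeAnticyclotomicEisensteinDivisibilityLocalEulerPoincareCorank
import Summits.BirchSwinnertonDyer.BirchSwinnertonDyer.Theorems.SchneiderFreeAdditiveX3GordTwoBranchIMCGreenbergDischarged
import HarnessLib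

/-!
# Route `SchneiderFreeAdditiveX3` (K1 door): the ALGEBRAIC λ-side of Keller–Yin 2410.23241 Thm. 3.5.1 at `p ≥ 5` RE-TYPED GREENBERG-FREE —
# on CGLS 2022 Prop. 1.2.5 (module clause AND corank clause), Prop. 14, Cor. 1.2.6 ×2 and Milne ADT I Thm. 4.10 (a) (restricted ramification,
# totally complex fields) — the currency of cell `bsd-eis`'s «OfSurC» / «prop411 DROP» re-typings

Cell `bsd-schneider-ideate`, seat `bsd-schneider-door-c5` (prover, generation 40; assembly layer; `--supports` 19177).  PARTITION: board row
B6 ∩ X3 ∩ sst-twist, `r = 1`, both semistable-twist halves at `p ≥ 5` (307 of 7 101 census pairs; class-wide every `p ≥ 5`) of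
`Rank1Residual.partition` — ASSEMBLY; types-the-object-of nothing new; RE-KEYS generation 24's algebraic λ-side (`KYLambdaAlg` PART 2 §4–§5,
`KYLambdaAlgChar` PART 3 §7–§9) off Greenberg's papers; closes none of B6's cells (BSD NOT advanced).  bears_on: K1-door (19177 r3).

WHY.  Generation 24 ported cell `bsd-eis`'s Greenberg–Vatsal/CGLS count to the semistable-twist datum with the named inputs `bsd-eis` then carried:
Greenberg 2016 Prop. 4.1.1 (`h411`, «𝔛^{Sf} has no `p`-torsion» via `XAcImprimitiveNoPTorsion.xAc_smul_eq_zero_imp_of_facts`), Prop. 2.6.3 (`h263`,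
CGLS Prop. 1.2.5's corank clause via `prop125_characterGrSelmerDual_corank_ge_of_facts`), Greenberg 2006 Props. 4.1 / 4.2 / §5 A / 3.2.  Since then
`bsd-eis` RE-TYPED both consumers (width seat x2-p2 gens 16–18): Prop. 4.1.1 ↦ Milne ADT I Thm. 4.10 (a) at finite `S` over totally complex fields
(`….xAc_smul_eq_zero_imp_ofPoitouTateAt`; the statement lane «PT-Ш-S-TC» is proving), Prop. 2.6.3 ↦ the NAMED corank clause
`prop125_characterGrSelmerDual_corank_ge` (CGLS Prop. 1.2.5, PUBLISHED; derivable in the tree from Prop. 2.6.3, from its case (c) at totally complex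
`K`, or from Milne I 4.10 (a)); Greenberg 2006 Props. 3.2 / 4.1 / 4.2 / §5 A became TREE THEOREMS.  THIS FILE re-types the door's `p ≥ 5` algebraic
λ-side onto that currency — proofs token-identical to generation 24's but for the two engine calls:
* §1 `charLambdaRelaxation_eq_of_ge` — CGLS Prop. 1.2.5's λ-clause at CHARACTER level from its module clause `hprop125` and corank clause `hge`.
* §2 `lambdaInvariant_xAc_eq_add_of_nonAnomalous_ofPT` / `…_of_classX3_of_subSemistableTwist_ofPT` / `lambdaInvariant_xAc_empty_add_zpCorank_eq_…_ofPT`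
  (PART 2 §4–§5 with `h411 ↦ hX`, Greenberg 2006 fed by tree theorems).
* §3 `lambdaInvariant_xAc_eq_add_add_sum_of_nonAnomalous_ofCGLS` / `…_of_classX3_of_subSemistableTwist_ofCGLS` / `…_empty_add_zpCorank_eq_add_add_sum_…_ofCGLS`
  and **`add_add_sum_le_lambdaInvariant_xAc_empty_add_sum_curveLocalLambda_…_ofCGLS`** (PART 3 §7–§9; the inequality the door's hinge consumes).

INPUT LEDGER of the door's algebraic λ-side at `p ≥ 5` after this file: SIX named statements — CGLS 2022 Prop. 1.2.5 (module/dim clause; corank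
clause), Prop. 14, Cor. 1.2.6 (i), (ii) [PUBLISHED, Invent. Math. 227] and Milne ADT I Thm. 4.10 (a) at finite `S` over totally complex fields
[TEXTBOOK; `poitouTate_shaRestricted_tateDual_natural_at`].  BEFORE (generation 24): TEN (the four CGLS + Greenberg 2016 ×2 + Greenberg 2006 ×4).

HONEST FRAMING: compositions of tree theorems, CONDITIONAL BY NAME on the displayed published statements (typed `Prop`s, not proved in the tree);
no definition, no named fact, no `sorry`; nothing analytic touched; nothing at `p = 3`; nothing about BSD or a main conjecture asserted; «closes rung:
none».  References: [CastellaGrossiLeeSkinner2022] Lemma 1.1.1, Prop. 1.2.5, Cor. 1.2.6, Prop. 14, §1.4; [MilneADT2006] I Thm. 4.10 (a); [KellerYin2024]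
Thm. 1.4.1; [KellerYin2024b] §3.5; [Greenberg2016Selmer] Props. 2.6.3, 4.1.1; [Greenberg2006] Props. 3.2, 4.1, 4.2, §5 A; [GreenbergVatsal2000] §2;
this seat p670905 / p671328 (gen 24), p754292 (F37); cell `bsd-eis` `…XAcImprimitiveNoPTorsionOfPoitouTateAt`, `…CharGrSelmerCorankGeOfFactsOfSurC`.
-/

set_option autoImplicit false
set_option linter.dupNamespace false -- the summit namespace `…BirchSwinnertonDyer.BirchSwinnertonDyer.Theorems` (Sub = Summit, D-0017) trips it

noncomputable section

open scoped Classical Pointwise NumberField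

namespace Summit.BirchSwinnertonDyer.BirchSwinnertonDyer.Theorems.SchneiderFreeAdditiveX3.KYLambdaAlgOfCGLS

open WeierstrassCurve NumberField IsDedekindDomain Field
  Literature.NumberTheory.EllipticCurves Literature.NumberTheory.EllipticCurves.IwasawaAlgebra
  Literature.NumberTheory.EllipticCurves.GreenbergSelmer
  Literature.NumberTheory.EllipticCurves.GreenbergVatsal2000
  Literature.NumberTheory.GaloisRepresentations Literature.NumberTheory.GaloisCohomology IsDedekindDomain.HeightOneSpectrum
  Literature.NumberTheory.EllipticCurves.Rank1Residual Literature.NumberTheory.EllipticCurves.KellerYin2024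
  Literature.NumberTheory.EllipticCurves.IwasawaDual Literature.NumberTheory.EllipticCurves.Castella2018.AcSelmer
  Literature.NumberTheory.IwasawaTheory Literature.NumberTheory.IwasawaTheory.Greenberg2016
  Literature.NumberTheory.IwasawaTheory.Greenberg2006
  Summit.BirchSwinnertonDyer.Rank1Residual Summit.BirchSwinnertonDyer.Rank1Residual.Additive
  Summit.BirchSwinnertonDyer.Rank1Residual.X2.ResidualDevissageModules
  Summit.BirchSwinnertonDyer.BirchSwinnertonDyer.Theorems
  Summit.BirchSwinnertonDyer.BirchSwinnertonDyer.Theorems.ResidualDevissageNonsplitLocalData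
  Summit.BirchSwinnertonDyer.BirchSwinnertonDyer.Theorems.ResidualDevissageNonsplitLambdaIdentityOfFacts
  Summit.BirchSwinnertonDyer.BirchSwinnertonDyer.Theorems.CumulativeHeegnerInclusionAtThreeResidualDevissage
  Summit.BirchSwinnertonDyer.BirchSwinnertonDyer.Theorems.SchneiderFreeAdditiveX3
  Summit.BirchSwinnertonDyer.BirchSwinnertonDyer.Theorems.SchneiderFreeAdditiveX3.KYLambdaAlg
  Summit.BirchSwinnertonDyer.BirchSwinnertonDyer.Theorems.SchneiderFreeAdditiveX3.KYLambdaAlgChar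
  Summit.BirchSwinnertonDyer.BirchSwinnertonDyer.Theorems.SchneiderFreeAdditiveX3.KYBranchGreenbergDischarged
open Literature.NumberTheory.EllipticCurves.CastellaGrossiLeeSkinner2022
  (cor126_residualCharacter_globalLift cor126_residualCharacter_localSurjective
    prop125_characterGrSelmerDual_torsion_muZero_dim prop125_characterGrSelmerDual_corank_ge prop14_residualCharacterSelmer_finite)

variable {p : ℕ} [hp : Fact p.Prime]

/-! ### §1 CGLS Prop. 1.2.5's λ-clause at character level from its module clause and its corank clause BY NAME -/

/-- **CGLS Prop. 1.2.5's `λ`-clause `λ(𝔛_θ^S) = λ(𝔛_θ) + Σ_{w∈S} λ(𝒫_w(θ))` at CHARACTER level, for ALL strict dual data, modulo its module clause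
`hprop125` and its corank clause `hge` BY NAME** (both PUBLISHED clauses of the same proposition; NO Greenberg input) — cell `bsd-eis`'s
`CharGrSelmerCorankGeOfFacts.charLambdaRelaxation_eq_of_facts` with its Greenberg-fed `prop125_characterGrSelmerDual_corank_ge_of_facts h263 h41 h42 h5A h32`
REPLACED by the named clause `hge`; `≤` is the kernel's `GrSelmerQuotientCorankLe.zpCorank_grSelmer_quotient_le_sum_charLocalLambda` (finitely
decomposed places by Brink).  Binders as in CGLS §1.2 (`p` odd, `K` imaginary quadratic, `(p)` split, `κ` anticyclotomic, `𝔭 = v̄`, `θ` Teichmüller-valued,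
unramified outside `S ∪ {w ∣ p}`, `θ|_{G_v̄} ≠ 𝟙, ω`). [cite: CastellaGrossiLeeSkinner2022, §1.2 Prop. 1.2.5 `propchar` and proof (eq:sur2), Lemma 1.1.1 (arXiv:2008.02571 Prop. 14, Lemma 9)]
[cite: GreenbergVatsal2000, §2 Cor. (2.3), Prop. (2.4)] [cite: Brink2007, Thm. 2] -/
theorem charLambdaRelaxation_eq_of_ge
    (hprop125 : prop125_characterGrSelmerDual_torsion_muZero_dim) (hge : prop125_characterGrSelmerDual_corank_ge)
    {K : Type} [Field K] [NumberField K] (hK : IsImaginaryQuadratic K) (hp2 : p ≠ 2)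
    (hsplit : ((Ideal.span {(p : ℤ)}).primesOver (𝓞 K)).ncard = 2)
    (κ : ZpExtension K p) (hκ : κ.IsAnticyclotomic) (γ : absoluteGaloisGroup K) (hγ : κ.IsTopGenerator γ)
    (vbar : HeightOneSpectrum (𝓞 K)) (hvbar : ((p : ℕ) : 𝓞 K) ∈ vbar.asIdeal)
    (θ : FramedGaloisRep K (padicCoeffIntegers (∅ : Set (PadicAlgCl p))) 1)
    (hθ : ∀ σ : absoluteGaloisGroup K, θ σ ^ (p - 1) = 1)
    (S : Finset (HeightOneSpectrum (𝓞 K)))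
    (hSmem : ∀ v ∈ S, ((p : ℕ) : 𝓞 K) ∉ v.asIdeal ∧ ((v.asIdeal.under ℤ).primesOver (𝓞 K)).ncard = 2)
    (hunr : ∀ v : HeightOneSpectrum (𝓞 K), v ∉ S → ((p : ℕ) : 𝓞 K) ∉ v.asIdeal →
      ∀ x ∈ inertia v, ∀ m : charModule (∅ : Set (PadicAlgCl p)) θ, p • m = 0 → x • m = m)
    (hne1 : ¬ ∀ g ∈ decomp vbar, ∀ m : charModule (∅ : Set (PadicAlgCl p)) θ, p • m = 0 → g • m = m)
    (hneω : ¬ ∀ g ∈ decomp vbar, ∀ m : charModule (∅ : Set (PadicAlgCl p)) θ, p • m = 0 →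
      g • m = ((modNCyclotomicCharacter K p g : (ZMod p)ˣ) : ZMod p).val • m)
    (DS : GrDualData κ (charModule (∅ : Set (PadicAlgCl p)) θ) vbar (↑S : Set (HeightOneSpectrum (𝓞 K))) γ)
    (D0 : GrDualData κ (charModule (∅ : Set (PadicAlgCl p)) θ) vbar (∅ : Set (HeightOneSpectrum (𝓞 K))) γ) :
    Module.Finite (IwasawaAlgebra p) D0.X ∧ Module.IsTorsion (IwasawaAlgebra p) D0.X ∧ muInvariant p D0.X = 0 ∧
      lambdaInvariant p DS.X = lambdaInvariant p D0.X + ∑ w ∈ S, charLocalLambda (∅ : Set (PadicAlgCl p)) κ θ w := by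
  obtain ⟨hfg0, hT0, hμ0, hlam, -⟩ := CharGrSelmerLambdaRelaxation.charLambdaRelaxation_of_facts hprop125 hge K hK hp2 hsplit κ hκ γ hγ
    vbar hvbar θ hθ S hSmem hunr hne1 hneω DS D0
  have hcork : zpCorank (↥(grSelmer κ (charModule (∅ : Set (PadicAlgCl p)) θ) vbar (↑S : Set (HeightOneSpectrum (𝓞 K)))) ⧸
        (grSelmer κ (charModule (∅ : Set (PadicAlgCl p)) θ) vbar (∅ : Set (HeightOneSpectrum (𝓞 K)))).addSubgroupOf
          (grSelmer κ (charModule (∅ : Set (PadicAlgCl p)) θ) vbar (↑S : Set (HeightOneSpectrum (𝓞 K))))) p =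
      ∑ w ∈ S, charLocalLambda (∅ : Set (PadicAlgCl p)) κ θ w :=
    le_antisymm
      (GrSelmerQuotientCorankLe.zpCorank_grSelmer_quotient_le_sum_charLocalLambda κ hγ vbar θ hθ S (fun w hw ↦ (hSmem w hw).1)
        fun w hw ↦ CharGrSelmerCorankGeOfFacts.exists_mem_decomp_apply_ne_one_of_ncard_primesOver_under hK hp2 κ hκ w (hSmem w hw).1
          (hSmem w hw).2)
      (hge K p hK hp2 hsplit κ hκ vbar hvbar θ hθ S hSmem hunr hne1 hneω)
  exact ⟨hfg0, hT0, hμ0, by rw [hlam, hcork]⟩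

/-! ### §2 [ALG-imp]: `λ(𝔛^{Sf}(E_K)) = λ(𝔛^{Sf}_{θsub}) + λ(𝔛^{Sf}_{θquot})`, with Greenberg 2016 Prop. 4.1.1 ↦ Milne ADT I Thm. 4.10 (a) -/

/-- **`λ(𝔛^{Sf}(E_K)) = λ(𝔛^{Sf}_{θsub}) + λ(𝔛^{Sf}_{θquot})` at every Eisenstein Heegner datum with the non-anomalous clause and EVERY residual pair,
MODULO CGLS 2022 Prop. 1.2.5 (module clause), Prop. 14, Cor. 1.2.6 (i)(ii) and Milne ADT I Thm. 4.10 (a) BY NAME** — PART 2 §4 with «`𝔛^{Sf}` has no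
`p`-torsion» from cell `bsd-eis`'s `XAcImprimitiveNoPTorsion.xAc_smul_eq_zero_imp_ofPoitouTateAt` (Greenberg 2016 Prop. 4.1.1 (c)'s consumed instance from
Milne I 4.10 (a) at the finite `S` over the imaginary quadratic `K`; Greenberg 2006 Props. 4.1 / 4.2 / 3.2 fed by tree theorems).
[cite: KellerYin2024, Thm. 1.4.1, §1.4 (e) (arXiv:2402.12781v2)] [cite: CastellaGrossiLeeSkinner2022, §1.2 Prop. 1.2.5, Prop. 14, Cor. 1.2.6, §1.4 Props. 1.4.1–1.4.2, Cor. 1.4.3]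
[cite: MilneADT2006, I Thm. 4.10 (a) (p. 57)] [cite: Greenberg2016Selmer, Prop. 4.1.1 (c) (its consumed instance)] -/
theorem lambdaInvariant_xAc_eq_add_of_nonAnomalous_ofPT
    (hprop125 : prop125_characterGrSelmerDual_torsion_muZero_dim) (hfact : prop14_residualCharacterSelmer_finite)
    (hlift : cor126_residualCharacter_globalLift) (hlocal : cor126_residualCharacter_localSurjective)
    (hX : ∀ (L : Type) [Field L] [NumberField L] [IsTotallyComplex L] (S : Set (HeightOneSpectrum (𝓞 L))),
      S.Finite → Literature.NumberTheory.GaloisCohomology.poitouTate_shaRestricted_tateDual_natural_at L S)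
    (W : WeierstrassCurve ℚ) [W.IsElliptic] [W.IsGloballyMinimal]
    (K : Type) [Field K] [NumberField K] {v : HeightOneSpectrum (𝓞 K)} (vbar : HeightOneSpectrum (𝓞 K))
    (κ : ZpExtension K p) (γ : absoluteGaloisGroup K) [Fact (κ.IsTopGenerator γ)]
    (Sf : Finset (HeightOneSpectrum (𝓞 K)))
    (hp2 : 2 < p) (hred : Red W p)
    (hK : IsImaginaryQuadratic K) (hH : SatisfiesHeegnerHypothesis (W.conductorNorm ℤ) K)
    (hsplit : ((Ideal.span {(p : ℤ)}).primesOver (𝓞 K)).ncard = 2)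
    (hv : ((p : ℕ) : 𝓞 K) ∈ v.asIdeal) (hvbar : ((p : ℕ) : 𝓞 K) ∈ vbar.asIdeal) (hne : vbar ≠ v) (hκ : κ.IsAnticyclotomic)
    (hSf : ∀ w : HeightOneSpectrum (𝓞 K), w ∈ Sf ↔
      (((W.conductorNorm ℤ : ℤ) : 𝓞 K) ∈ w.asIdeal ∧ ((p : ℕ) : 𝓞 K) ∉ w.asIdeal))
    (hna : ∀ (v : HeightOneSpectrum (𝓞 ℚ)), ((p : ℕ) : 𝓞 ℚ) ∈ v.asIdeal →
      ∀ (Φ : AddSubgroup (geomTorsion W (p : ℤ))), Nat.card Φ = p →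
      ∀ 𝔓 ∈ v.primesAbove,
        (¬ ∀ g ∈ 𝔓.decompositionSubgroup (absoluteGaloisGroup ℚ), ∀ P ∈ Φ, g • P = P) ∧
          (¬ ∀ g ∈ 𝔓.decompositionSubgroup (absoluteGaloisGroup ℚ),
            ∀ P : geomTorsion W (p : ℤ), g • P - P ∈ Φ))
    (θsub θquot : FramedGaloisRep K (padicCoeffIntegers (∅ : Set (PadicAlgCl p))) 1)
    (hpair : IsResidualPairOver (W.baseChange K) p θsub θquot)
    (Dsub : GrDualData κ (charModule (∅ : Set (PadicAlgCl p)) θsub) vbar (↑Sf : Set (HeightOneSpectrum (𝓞 K))) γ)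
    (Dquot : GrDualData κ (charModule (∅ : Set (PadicAlgCl p)) θquot) vbar (↑Sf : Set (HeightOneSpectrum (𝓞 K))) γ) :
    lambdaInvariant p (XAc (W.baseChange K) p κ vbar (↑Sf : Set (HeightOneSpectrum (𝓞 K))) γ) =
      lambdaInvariant p Dsub.X + lambdaInvariant p Dquot.X := by
  obtain ⟨hXfin, hXtor, hμ⟩ := xAc_moduleFinite_isTorsion_muInvariant_of_prop14_of_nonAnomalous hfact W K vbar κ γ Sf hp2 hred
    hK hH hsplit hvbar hκ hSf hna
  exact (lambdaInvariant_le_add_of_isResidualPairOver_of_nonAnomalous hprop125 hlift hlocal W K vbar κ γ Sf hp2 hK hH hsplit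
    hvbar hκ hSf hna θsub θquot hpair Dsub Dquot).2.2
    (fun x hx ↦ XAcImprimitiveNoPTorsion.xAc_smul_eq_zero_imp_ofPoitouTateAt hX greenberg2006_prop41_ofTree
      Greenberg2006.prop42_localEulerPoincareCorank_holds prop32_cohomology_isCofinitelyGenerated_holds W hp2 hK hH hv hvbar hne κ hκ γ
      Sf hSf hXfin hXtor hμ x hx)

/-- **§2 on the semistable-twist cells of B6 ∩ X3 at `p ≥ 5`** (`hna` from `SemistableTwistLocalAnyLine`): `λ(X_ac^{Sf}(E_K)) = λ(𝔛^{Sf}_{θsub}) +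
λ(𝔛^{Sf}_{θquot})` modulo CGLS ×4 and Milne I 4.10 (a). [cite: CastellaGrossiLeeSkinner2022, §1.2 Prop. 1.2.5, Prop. 14, Cor. 1.2.6, §1.4]
[cite: MilneADT2006, I Thm. 4.10 (a)] [cite: Serre1972, §1.11–1.12] -/
theorem lambdaInvariant_xAc_eq_add_of_classX3_of_subSemistableTwist_ofPT
    (hprop125 : prop125_characterGrSelmerDual_torsion_muZero_dim) (hfact : prop14_residualCharacterSelmer_finite)
    (hlift : cor126_residualCharacter_globalLift) (hlocal : cor126_residualCharacter_localSurjective)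
    (hX : ∀ (L : Type) [Field L] [NumberField L] [IsTotallyComplex L] (S : Set (HeightOneSpectrum (𝓞 L))),
      S.Finite → Literature.NumberTheory.GaloisCohomology.poitouTate_shaRestricted_tateDual_natural_at L S)
    (W : WeierstrassCurve ℚ) [W.IsElliptic] [W.IsGloballyMinimal]
    (K : Type) [Field K] [NumberField K] {v : HeightOneSpectrum (𝓞 K)} (vbar : HeightOneSpectrum (𝓞 K))
    (κ : ZpExtension K p) (γ : absoluteGaloisGroup K) [Fact (κ.IsTopGenerator γ)]
    (Sf : Finset (HeightOneSpectrum (𝓞 K)))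
    (hp5 : 5 ≤ p) (hX3 : ClassX3 W p) (hSST : SubSemistableTwist W p)
    (hK : IsImaginaryQuadratic K) (hH : SatisfiesHeegnerHypothesis (W.conductorNorm ℤ) K)
    (hsplit : ((Ideal.span {(p : ℤ)}).primesOver (𝓞 K)).ncard = 2)
    (hv : ((p : ℕ) : 𝓞 K) ∈ v.asIdeal) (hvbar : ((p : ℕ) : 𝓞 K) ∈ vbar.asIdeal) (hne : vbar ≠ v) (hκ : κ.IsAnticyclotomic)
    (hSf : ∀ w : HeightOneSpectrum (𝓞 K), w ∈ Sf ↔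
      (((W.conductorNorm ℤ : ℤ) : 𝓞 K) ∈ w.asIdeal ∧ ((p : ℕ) : 𝓞 K) ∉ w.asIdeal))
    (θsub θquot : FramedGaloisRep K (padicCoeffIntegers (∅ : Set (PadicAlgCl p))) 1)
    (hpair : IsResidualPairOver (W.baseChange K) p θsub θquot)
    (Dsub : GrDualData κ (charModule (∅ : Set (PadicAlgCl p)) θsub) vbar (↑Sf : Set (HeightOneSpectrum (𝓞 K))) γ)
    (Dquot : GrDualData κ (charModule (∅ : Set (PadicAlgCl p)) θquot) vbar (↑Sf : Set (HeightOneSpectrum (𝓞 K))) γ) :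
    lambdaInvariant p (XAc (W.baseChange K) p κ vbar (↑Sf : Set (HeightOneSpectrum (𝓞 K))) γ) =
      lambdaInvariant p Dsub.X + lambdaInvariant p Dquot.X :=
  lambdaInvariant_xAc_eq_add_of_nonAnomalous_ofPT hprop125 hfact hlift hlocal hX W K vbar κ γ Sf (by omega) hX3.1 hK hH hsplit hv hvbar
    hne hκ hSf
    (fun _ hpv _ hΦ _ h𝔓 ↦
      SemistableTwistLocalAnyLine.not_fix_and_not_quot_of_classX3_of_subSemistableTwist_of_card_eq W p hp5 hX3 hSST hpv h𝔓 hΦ)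
    θsub θquot hpair Dsub Dquot

/-- **The door's PRIMITIVE dual, Greenberg-free:** `X_ac^∅(E_K)` f.g. `Λ`-torsion with `μ = 0` and `λ(X_ac^∅(E_K)) + corank_{ℤ_p}(Sel^{Sf}/Sel^∅) =
λ(𝔛^{Sf}_{θsub}) + λ(𝔛^{Sf}_{θquot})` at `p ≥ 5` on both semistable-twist cells (PART 2 §5 re-typed: λ-shift + §2).
[cite: KellerYin2024, Thm. 1.4.1 and proof of Thm. 1.5.1 (arXiv:2402.12781v2)] [cite: CastellaGrossiLeeSkinner2022, §1.2 Prop. 1.2.5, Prop. 14, Cor. 1.2.6, §1.4]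
[cite: MilneADT2006, I Thm. 4.10 (a)] -/
theorem lambdaInvariant_xAc_empty_add_zpCorank_eq_of_classX3_of_subSemistableTwist_ofPT
    (hprop125 : prop125_characterGrSelmerDual_torsion_muZero_dim) (hfact : prop14_residualCharacterSelmer_finite)
    (hlift : cor126_residualCharacter_globalLift) (hlocal : cor126_residualCharacter_localSurjective)
    (hX : ∀ (L : Type) [Field L] [NumberField L] [IsTotallyComplex L] (S : Set (HeightOneSpectrum (𝓞 L))),
      S.Finite → Literature.NumberTheory.GaloisCohomology.poitouTate_shaRestricted_tateDual_natural_at L S)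
    (W : WeierstrassCurve ℚ) [W.IsElliptic] [W.IsGloballyMinimal]
    (K : Type) [Field K] [NumberField K] {v : HeightOneSpectrum (𝓞 K)} (vbar : HeightOneSpectrum (𝓞 K))
    (κ : ZpExtension K p) (γ : absoluteGaloisGroup K) [Fact (κ.IsTopGenerator γ)]
    (Sf : Finset (HeightOneSpectrum (𝓞 K)))
    (hp5 : 5 ≤ p) (hX3 : ClassX3 W p) (hSST : SubSemistableTwist W p)
    (hK : IsImaginaryQuadratic K) (hH : SatisfiesHeegnerHypothesis (W.conductorNorm ℤ) K)
    (hsplit : ((Ideal.span {(p : ℤ)}).primesOver (𝓞 K)).ncard = 2)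
    (hv : ((p : ℕ) : 𝓞 K) ∈ v.asIdeal) (hvbar : ((p : ℕ) : 𝓞 K) ∈ vbar.asIdeal) (hne : vbar ≠ v) (hκ : κ.IsAnticyclotomic)
    (hSf : ∀ w : HeightOneSpectrum (𝓞 K), w ∈ Sf ↔
      (((W.conductorNorm ℤ : ℤ) : 𝓞 K) ∈ w.asIdeal ∧ ((p : ℕ) : 𝓞 K) ∉ w.asIdeal))
    (θsub θquot : FramedGaloisRep K (padicCoeffIntegers (∅ : Set (PadicAlgCl p))) 1)
    (hpair : IsResidualPairOver (W.baseChange K) p θsub θquot)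
    (Dsub : GrDualData κ (charModule (∅ : Set (PadicAlgCl p)) θsub) vbar (↑Sf : Set (HeightOneSpectrum (𝓞 K))) γ)
    (Dquot : GrDualData κ (charModule (∅ : Set (PadicAlgCl p)) θquot) vbar (↑Sf : Set (HeightOneSpectrum (𝓞 K))) γ) :
    Module.Finite (IwasawaAlgebra p) (XAc (W.baseChange K) p κ vbar (∅ : Set (HeightOneSpectrum (𝓞 K))) γ) ∧
      Module.IsTorsion (IwasawaAlgebra p) (XAc (W.baseChange K) p κ vbar (∅ : Set (HeightOneSpectrum (𝓞 K))) γ) ∧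
      muInvariant p (XAc (W.baseChange K) p κ vbar (∅ : Set (HeightOneSpectrum (𝓞 K))) γ) = 0 ∧
      lambdaInvariant p (XAc (W.baseChange K) p κ vbar (∅ : Set (HeightOneSpectrum (𝓞 K))) γ) +
          zpCorank (↥(selmerAc (W.baseChange K) p κ vbar (↑Sf : Set (HeightOneSpectrum (𝓞 K)))) ⧸
            (selmerAc (W.baseChange K) p κ vbar (∅ : Set (HeightOneSpectrum (𝓞 K)))).addSubgroupOf
              (selmerAc (W.baseChange K) p κ vbar (↑Sf : Set (HeightOneSpectrum (𝓞 K))))) p =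
        lambdaInvariant p Dsub.X + lambdaInvariant p Dquot.X := by
  haveI hEK : (W.baseChange K).IsElliptic := inferInstanceAs (W.map (algebraMap ℚ K)).IsElliptic
  obtain ⟨hXfin, hXtor, hμ⟩ := xAc_moduleFinite_isTorsion_muInvariant_of_prop14_of_classX3_of_subSemistableTwist hfact W K vbar
    κ γ Sf hp5 hX3 hSST hK hH hsplit hvbar hκ hSf
  haveI := hXfin
  obtain ⟨hfin₀, htor₀, hμ₀, -, hshift⟩ :=
    XAcImprimitiveLambdaShift.lambdaInvariant_eq_add_zpCorank_of_muInvariant_eq_zero (W.baseChange K) p κ vbar γ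
      (Set.empty_subset (↑Sf : Set (HeightOneSpectrum (𝓞 K)))) hXtor hμ
  have heq := lambdaInvariant_xAc_eq_add_of_classX3_of_subSemistableTwist_ofPT hprop125 hfact hlift hlocal hX W K vbar κ γ Sf hp5
    hX3 hSST hK hH hsplit hv hvbar hne hκ hSf θsub θquot hpair Dsub Dquot
  exact ⟨hfin₀, htor₀, hμ₀, by rw [← heq, hshift]⟩

/-! ### §3 [ALG-imp] + [PWL-θ] in one currency, and the inequality the door consumes — Greenberg-free -/

/-- **`λ(X_ac^{Sf}(E_K)) = λ(𝔛_{θsub}) + λ(𝔛_{θquot}) + Σ_{w∈Sf}(λ𝒫_w(θsub) + λ𝒫_w(θquot))` at every Eisenstein Heegner datum with the non-anomalous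
clause and EVERY residual pair, modulo CGLS Prop. 1.2.5 (module + corank clauses), Prop. 14, Cor. 1.2.6 (i)(ii) and Milne I 4.10 (a) BY NAME** —
PART 3 §7 re-typed: §2 composed with §1 for both characters (binders from `KYLambdaAlgChar.charHypotheses_of_nonAnomalous`).
[cite: CastellaGrossiLeeSkinner2022, §1.2 Prop. 1.2.5 (module and λ-clauses), Cor. 1.2.6, Prop. 14, §1.4, proof of Thm. 1.5.1 (eq:lambda-imp)]
[cite: KellerYin2024, Prop. 1.2.5, Thm. 1.4.1, Thm. 1.5.1 (arXiv:2402.12781v2)] [cite: MilneADT2006, I Thm. 4.10 (a)] [cite: GreenbergVatsal2000, §2 Cor. (2.3), Prop. (2.4)] -/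
theorem lambdaInvariant_xAc_eq_add_add_sum_of_nonAnomalous_ofCGLS
    (hprop125 : prop125_characterGrSelmerDual_torsion_muZero_dim) (hge : prop125_characterGrSelmerDual_corank_ge)
    (hfact : prop14_residualCharacterSelmer_finite)
    (hlift : cor126_residualCharacter_globalLift) (hlocal : cor126_residualCharacter_localSurjective)
    (hX : ∀ (L : Type) [Field L] [NumberField L] [IsTotallyComplex L] (S : Set (HeightOneSpectrum (𝓞 L))),
      S.Finite → Literature.NumberTheory.GaloisCohomology.poitouTate_shaRestricted_tateDual_natural_at L S)
    (W : WeierstrassCurve ℚ) [W.IsElliptic] [W.IsGloballyMinimal]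
    (K : Type) [Field K] [NumberField K] {v : HeightOneSpectrum (𝓞 K)} (vbar : HeightOneSpectrum (𝓞 K))
    (κ : ZpExtension K p) (γ : absoluteGaloisGroup K) [hγ : Fact (κ.IsTopGenerator γ)]
    (Sf : Finset (HeightOneSpectrum (𝓞 K)))
    (hp2 : 2 < p) (hred : Red W p)
    (hK : IsImaginaryQuadratic K) (hH : SatisfiesHeegnerHypothesis (W.conductorNorm ℤ) K)
    (hsplit : ((Ideal.span {(p : ℤ)}).primesOver (𝓞 K)).ncard = 2)
    (hv : ((p : ℕ) : 𝓞 K) ∈ v.asIdeal) (hvbar : ((p : ℕ) : 𝓞 K) ∈ vbar.asIdeal) (hne : vbar ≠ v) (hκ : κ.IsAnticyclotomic)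
    (hSf : ∀ w : HeightOneSpectrum (𝓞 K), w ∈ Sf ↔
      (((W.conductorNorm ℤ : ℤ) : 𝓞 K) ∈ w.asIdeal ∧ ((p : ℕ) : 𝓞 K) ∉ w.asIdeal))
    (hna : ∀ (v : HeightOneSpectrum (𝓞 ℚ)), ((p : ℕ) : 𝓞 ℚ) ∈ v.asIdeal →
      ∀ (Φ : AddSubgroup (geomTorsion W (p : ℤ))), Nat.card Φ = p →
      ∀ 𝔓 ∈ v.primesAbove,
        (¬ ∀ g ∈ 𝔓.decompositionSubgroup (absoluteGaloisGroup ℚ), ∀ P ∈ Φ, g • P = P) ∧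
          (¬ ∀ g ∈ 𝔓.decompositionSubgroup (absoluteGaloisGroup ℚ),
            ∀ P : geomTorsion W (p : ℤ), g • P - P ∈ Φ))
    (θsub θquot : FramedGaloisRep K (padicCoeffIntegers (∅ : Set (PadicAlgCl p))) 1)
    (hpair : IsResidualPairOver (W.baseChange K) p θsub θquot)
    (D0sub : GrDualData κ (charModule (∅ : Set (PadicAlgCl p)) θsub) vbar (∅ : Set (HeightOneSpectrum (𝓞 K))) γ)
    (D0quot : GrDualData κ (charModule (∅ : Set (PadicAlgCl p)) θquot) vbar (∅ : Set (HeightOneSpectrum (𝓞 K))) γ) :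
    lambdaInvariant p (XAc (W.baseChange K) p κ vbar (↑Sf : Set (HeightOneSpectrum (𝓞 K))) γ) =
      lambdaInvariant p D0sub.X + lambdaInvariant p D0quot.X +
        ∑ w ∈ Sf, (charLocalLambda (∅ : Set (PadicAlgCl p)) κ θsub w + charLocalLambda (∅ : Set (PadicAlgCl p)) κ θquot w) := by
  have hp2' : p ≠ 2 := by omega
  -- auxiliary strict dual data at `Sf` exist unconditionally
  obtain ⟨Dsub⟩ := nonempty_grDualData_char (∅ : Set (PadicAlgCl p)) θsub κ vbar (↑Sf : Set (HeightOneSpectrum (𝓞 K))) hγ.out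
  obtain ⟨Dquot⟩ := nonempty_grDualData_char (∅ : Set (PadicAlgCl p)) θquot κ vbar (↑Sf : Set (HeightOneSpectrum (𝓞 K))) hγ.out
  have halg := lambdaInvariant_xAc_eq_add_of_nonAnomalous_ofPT hprop125 hfact hlift hlocal hX W K vbar κ γ Sf hp2 hred hK hH hsplit hv
    hvbar hne hκ hSf hna θsub θquot hpair Dsub Dquot
  obtain ⟨hSmem, hchar⟩ := charHypotheses_of_nonAnomalous W K vbar κ Sf hK hH hsplit hvbar hSf hna θsub θquot hpair
  obtain ⟨hθT₁, hunr₁, hne1₁, hneω₁⟩ := hchar θsub (Or.inl rfl)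
  obtain ⟨hθT₂, hunr₂, hne1₂, hneω₂⟩ := hchar θquot (Or.inr rfl)
  obtain ⟨-, -, -, hsub⟩ := charLambdaRelaxation_eq_of_ge hprop125 hge hK hp2' hsplit κ hκ γ hγ.out vbar hvbar θsub hθT₁ Sf hSmem hunr₁
    hne1₁ hneω₁ Dsub D0sub
  obtain ⟨-, -, -, hquot⟩ := charLambdaRelaxation_eq_of_ge hprop125 hge hK hp2' hsplit κ hκ γ hγ.out vbar hvbar θquot hθT₂ Sf hSmem hunr₂
    hne1₂ hneω₂ Dquot D0quot
  rw [Finset.sum_add_distrib, halg, hsub, hquot]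
  ring

/-- **§3 on the semistable-twist cells of B6 ∩ X3 at `p ≥ 5`**, for every residual pair and ALL primitive strict dual data, modulo CGLS Prop. 1.2.5
(both clauses), Prop. 14, Cor. 1.2.6 ×2 and Milne I 4.10 (a). [cite: CastellaGrossiLeeSkinner2022, §1.2 Prop. 1.2.5, Cor. 1.2.6, Prop. 14, §1.4]
[cite: MilneADT2006, I Thm. 4.10 (a)] -/
theorem lambdaInvariant_xAc_eq_add_add_sum_of_classX3_of_subSemistableTwist_ofCGLS
    (hprop125 : prop125_characterGrSelmerDual_torsion_muZero_dim) (hge : prop125_characterGrSelmerDual_corank_ge)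
    (hfact : prop14_residualCharacterSelmer_finite)
    (hlift : cor126_residualCharacter_globalLift) (hlocal : cor126_residualCharacter_localSurjective)
    (hX : ∀ (L : Type) [Field L] [NumberField L] [IsTotallyComplex L] (S : Set (HeightOneSpectrum (𝓞 L))),
      S.Finite → Literature.NumberTheory.GaloisCohomology.poitouTate_shaRestricted_tateDual_natural_at L S)
    (W : WeierstrassCurve ℚ) [W.IsElliptic] [W.IsGloballyMinimal]
    (K : Type) [Field K] [NumberField K] {v : HeightOneSpectrum (𝓞 K)} (vbar : HeightOneSpectrum (𝓞 K))
    (κ : ZpExtension K p) (γ : absoluteGaloisGroup K) [Fact (κ.IsTopGenerator γ)]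
    (Sf : Finset (HeightOneSpectrum (𝓞 K)))
    (hp5 : 5 ≤ p) (hX3 : ClassX3 W p) (hSST : SubSemistableTwist W p)
    (hK : IsImaginaryQuadratic K) (hH : SatisfiesHeegnerHypothesis (W.conductorNorm ℤ) K)
    (hsplit : ((Ideal.span {(p : ℤ)}).primesOver (𝓞 K)).ncard = 2)
    (hv : ((p : ℕ) : 𝓞 K) ∈ v.asIdeal) (hvbar : ((p : ℕ) : 𝓞 K) ∈ vbar.asIdeal) (hne : vbar ≠ v) (hκ : κ.IsAnticyclotomic)
    (hSf : ∀ w : HeightOneSpectrum (𝓞 K), w ∈ Sf ↔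
      (((W.conductorNorm ℤ : ℤ) : 𝓞 K) ∈ w.asIdeal ∧ ((p : ℕ) : 𝓞 K) ∉ w.asIdeal))
    (θsub θquot : FramedGaloisRep K (padicCoeffIntegers (∅ : Set (PadicAlgCl p))) 1)
    (hpair : IsResidualPairOver (W.baseChange K) p θsub θquot)
    (D0sub : GrDualData κ (charModule (∅ : Set (PadicAlgCl p)) θsub) vbar (∅ : Set (HeightOneSpectrum (𝓞 K))) γ)
    (D0quot : GrDualData κ (charModule (∅ : Set (PadicAlgCl p)) θquot) vbar (∅ : Set (HeightOneSpectrum (𝓞 K))) γ) :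
    lambdaInvariant p (XAc (W.baseChange K) p κ vbar (↑Sf : Set (HeightOneSpectrum (𝓞 K))) γ) =
      lambdaInvariant p D0sub.X + lambdaInvariant p D0quot.X +
        ∑ w ∈ Sf, (charLocalLambda (∅ : Set (PadicAlgCl p)) κ θsub w + charLocalLambda (∅ : Set (PadicAlgCl p)) κ θquot w) :=
  lambdaInvariant_xAc_eq_add_add_sum_of_nonAnomalous_ofCGLS hprop125 hge hfact hlift hlocal hX W K vbar κ γ Sf (by omega) hX3.1 hK hH
    hsplit hv hvbar hne hκ hSf
    (fun _ hpv _ hΦ _ h𝔓 ↦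
      SemistableTwistLocalAnyLine.not_fix_and_not_quot_of_classX3_of_subSemistableTwist_of_card_eq W p hp5 hX3 hSST hpv h𝔓 hΦ)
    θsub θquot hpair D0sub D0quot

/-- **`λ(X_ac^∅(E_K)) + corank_{ℤ_p}(Sel_{v̄}^{Sf}/Sel_{v̄}^∅) = λ(𝔛_{θsub}) + λ(𝔛_{θquot}) + Σ_{w∈Sf}(λ𝒫_w(θsub) + λ𝒫_w(θquot))` at `p ≥ 5` on both
semistable-twist cells, Greenberg-free** — PART 3 §8 re-typed on CGLS ×5 + Milne I 4.10 (a).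
[cite: CastellaGrossiLeeSkinner2022, §1.2 Prop. 1.2.5, Cor. 1.2.6, Prop. 14, §1.4, proof of Thm. 1.5.1] [cite: MilneADT2006, I Thm. 4.10 (a)] [cite: GreenbergVatsal2000, §2 Cor. (2.3)] -/
theorem lambdaInvariant_xAc_empty_add_zpCorank_eq_add_add_sum_of_classX3_of_subSemistableTwist_ofCGLS
    (hprop125 : prop125_characterGrSelmerDual_torsion_muZero_dim) (hge : prop125_characterGrSelmerDual_corank_ge)
    (hfact : prop14_residualCharacterSelmer_finite)
    (hlift : cor126_residualCharacter_globalLift) (hlocal : cor126_residualCharacter_localSurjective)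
    (hX : ∀ (L : Type) [Field L] [NumberField L] [IsTotallyComplex L] (S : Set (HeightOneSpectrum (𝓞 L))),
      S.Finite → Literature.NumberTheory.GaloisCohomology.poitouTate_shaRestricted_tateDual_natural_at L S)
    (W : WeierstrassCurve ℚ) [W.IsElliptic] [W.IsGloballyMinimal]
    (K : Type) [Field K] [NumberField K] {v : HeightOneSpectrum (𝓞 K)} (vbar : HeightOneSpectrum (𝓞 K))
    (κ : ZpExtension K p) (γ : absoluteGaloisGroup K) [hγ : Fact (κ.IsTopGenerator γ)]
    (Sf : Finset (HeightOneSpectrum (𝓞 K)))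
    (hp5 : 5 ≤ p) (hX3 : ClassX3 W p) (hSST : SubSemistableTwist W p)
    (hK : IsImaginaryQuadratic K) (hH : SatisfiesHeegnerHypothesis (W.conductorNorm ℤ) K)
    (hsplit : ((Ideal.span {(p : ℤ)}).primesOver (𝓞 K)).ncard = 2)
    (hv : ((p : ℕ) : 𝓞 K) ∈ v.asIdeal) (hvbar : ((p : ℕ) : 𝓞 K) ∈ vbar.asIdeal) (hne : vbar ≠ v) (hκ : κ.IsAnticyclotomic)
    (hSf : ∀ w : HeightOneSpectrum (𝓞 K), w ∈ Sf ↔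
      (((W.conductorNorm ℤ : ℤ) : 𝓞 K) ∈ w.asIdeal ∧ ((p : ℕ) : 𝓞 K) ∉ w.asIdeal))
    (θsub θquot : FramedGaloisRep K (padicCoeffIntegers (∅ : Set (PadicAlgCl p))) 1)
    (hpair : IsResidualPairOver (W.baseChange K) p θsub θquot)
    (D0sub : GrDualData κ (charModule (∅ : Set (PadicAlgCl p)) θsub) vbar (∅ : Set (HeightOneSpectrum (𝓞 K))) γ)
    (D0quot : GrDualData κ (charModule (∅ : Set (PadicAlgCl p)) θquot) vbar (∅ : Set (HeightOneSpectrum (𝓞 K))) γ) :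
    lambdaInvariant p (XAc (W.baseChange K) p κ vbar (∅ : Set (HeightOneSpectrum (𝓞 K))) γ) +
        zpCorank (↥(selmerAc (W.baseChange K) p κ vbar (↑Sf : Set (HeightOneSpectrum (𝓞 K)))) ⧸
          (selmerAc (W.baseChange K) p κ vbar (∅ : Set (HeightOneSpectrum (𝓞 K)))).addSubgroupOf
            (selmerAc (W.baseChange K) p κ vbar (↑Sf : Set (HeightOneSpectrum (𝓞 K))))) p =
      lambdaInvariant p D0sub.X + lambdaInvariant p D0quot.X +
        ∑ w ∈ Sf, (charLocalLambda (∅ : Set (PadicAlgCl p)) κ θsub w + charLocalLambda (∅ : Set (PadicAlgCl p)) κ θquot w) := by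
  obtain ⟨Dsub⟩ := nonempty_grDualData_char (∅ : Set (PadicAlgCl p)) θsub κ vbar (↑Sf : Set (HeightOneSpectrum (𝓞 K))) hγ.out
  obtain ⟨Dquot⟩ := nonempty_grDualData_char (∅ : Set (PadicAlgCl p)) θquot κ vbar (↑Sf : Set (HeightOneSpectrum (𝓞 K))) hγ.out
  obtain ⟨-, -, -, hshift⟩ := lambdaInvariant_xAc_empty_add_zpCorank_eq_of_classX3_of_subSemistableTwist_ofPT hprop125 hfact hlift hlocal hX W K
    vbar κ γ Sf hp5 hX3 hSST hK hH hsplit hv hvbar hne hκ hSf θsub θquot hpair Dsub Dquot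
  have himp := lambdaInvariant_xAc_eq_add_of_classX3_of_subSemistableTwist_ofPT hprop125 hfact hlift hlocal hX W K vbar κ γ Sf hp5 hX3 hSST
    hK hH hsplit hv hvbar hne hκ hSf θsub θquot hpair Dsub Dquot
  have hchar := lambdaInvariant_xAc_eq_add_add_sum_of_classX3_of_subSemistableTwist_ofCGLS hprop125 hge hfact hlift hlocal hX W K vbar κ γ Sf
    hp5 hX3 hSST hK hH hsplit hv hvbar hne hκ hSf θsub θquot hpair D0sub D0quot
  rw [hshift, ← himp, hchar]

/-- **The inequality the door's hinge consumes, Greenberg-free:** `λ(𝔛_{θsub}) + λ(𝔛_{θquot}) + Σ_{w∈Sf}(λ𝒫_w(θsub) + λ𝒫_w(θquot)) ≤ λ(X_ac^∅(E_K)) +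
Σ_{w∈Sf} λ𝒫_w(E_K)` at `p ≥ 5` on BOTH semistable-twist cells of B6 ∩ X3, for every residual pair and ALL primitive strict dual data, modulo CGLS
Prop. 1.2.5 (both clauses), Prop. 14, Cor. 1.2.6 ×2 and Milne I 4.10 (a) — PART 3 §9 re-typed (the above + cell `bsd-eis`'s UNCONDITIONAL
`FSideCorankLeOffP.zpCorank_selmerAc_quotient_le_sum_curveLocalLambda_of_offP_iff`).
[cite: KellerYin2024b, Thm. 3.5.1 first sentence "λ(𝔛) = λ(𝓛_ε)" (arXiv:2410.23241 p. 20) (preprint; algebraic side derived at p ≥ 5)]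
[cite: GreenbergVatsal2000, §2 Cor. (2.3), Prop. (2.4) pp. 22–23] [cite: CastellaGrossiLeeSkinner2022, §1.2 Prop. 1.2.5, Cor. 1.2.6, Prop. 14, §1.4]
[cite: MilneADT2006, I Thm. 4.10 (a)] [cite: SilvermanATAEC1994, Ch. V Thm. 5.3, Cor. 5.4] -/
theorem add_add_sum_le_lambdaInvariant_xAc_empty_add_sum_curveLocalLambda_of_classX3_of_subSemistableTwist_ofCGLS
    (hprop125 : prop125_characterGrSelmerDual_torsion_muZero_dim) (hge : prop125_characterGrSelmerDual_corank_ge)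
    (hfact : prop14_residualCharacterSelmer_finite)
    (hlift : cor126_residualCharacter_globalLift) (hlocal : cor126_residualCharacter_localSurjective)
    (hX : ∀ (L : Type) [Field L] [NumberField L] [IsTotallyComplex L] (S : Set (HeightOneSpectrum (𝓞 L))),
      S.Finite → Literature.NumberTheory.GaloisCohomology.poitouTate_shaRestricted_tateDual_natural_at L S)
    (W : WeierstrassCurve ℚ) [W.IsElliptic] [W.IsGloballyMinimal]
    (K : Type) [Field K] [NumberField K] {v : HeightOneSpectrum (𝓞 K)} (vbar : HeightOneSpectrum (𝓞 K))
    (κ : ZpExtension K p) (γ : absoluteGaloisGroup K) [hγ : Fact (κ.IsTopGenerator γ)]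
    (Sf : Finset (HeightOneSpectrum (𝓞 K)))
    (hp5 : 5 ≤ p) (hX3 : ClassX3 W p) (hSST : SubSemistableTwist W p)
    (hK : IsImaginaryQuadratic K) (hH : SatisfiesHeegnerHypothesis (W.conductorNorm ℤ) K)
    (hsplit : ((Ideal.span {(p : ℤ)}).primesOver (𝓞 K)).ncard = 2)
    (hv : ((p : ℕ) : 𝓞 K) ∈ v.asIdeal) (hvbar : ((p : ℕ) : 𝓞 K) ∈ vbar.asIdeal) (hne : vbar ≠ v) (hκ : κ.IsAnticyclotomic)
    (hSf : ∀ w : HeightOneSpectrum (𝓞 K), w ∈ Sf ↔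
      (((W.conductorNorm ℤ : ℤ) : 𝓞 K) ∈ w.asIdeal ∧ ((p : ℕ) : 𝓞 K) ∉ w.asIdeal))
    (θsub θquot : FramedGaloisRep K (padicCoeffIntegers (∅ : Set (PadicAlgCl p))) 1)
    (hpair : IsResidualPairOver (W.baseChange K) p θsub θquot)
    (D0sub : GrDualData κ (charModule (∅ : Set (PadicAlgCl p)) θsub) vbar (∅ : Set (HeightOneSpectrum (𝓞 K))) γ)
    (D0quot : GrDualData κ (charModule (∅ : Set (PadicAlgCl p)) θquot) vbar (∅ : Set (HeightOneSpectrum (𝓞 K))) γ) :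
    lambdaInvariant p D0sub.X + lambdaInvariant p D0quot.X +
        ∑ w ∈ Sf, (charLocalLambda (∅ : Set (PadicAlgCl p)) κ θsub w + charLocalLambda (∅ : Set (PadicAlgCl p)) κ θquot w) ≤
      lambdaInvariant p (XAc (W.baseChange K) p κ vbar (∅ : Set (HeightOneSpectrum (𝓞 K))) γ) +
        ∑ w ∈ Sf, curveLocalLambda κ (W.baseChange K) w := by
  have heq := lambdaInvariant_xAc_empty_add_zpCorank_eq_add_add_sum_of_classX3_of_subSemistableTwist_ofCGLS hprop125 hge hfact hlift hlocal hX
    W K vbar κ γ Sf hp5 hX3 hSST hK hH hsplit hv hvbar hne hκ hSf θsub θquot hpair D0sub D0quot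
  have hle := FSideCorankLeOffP.zpCorank_selmerAc_quotient_le_sum_curveLocalLambda_of_offP_iff W (by omega) hK hH κ hκ hγ.out
    vbar Sf hSf
  rw [← heq]
  exact Nat.add_le_add_left hle _

end Summit.BirchSwinnertonDyer.BirchSwinnertonDyer.Theorems.SchneiderFreeAdditiveX3.KYLambdaAlgOfCGLS

end
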